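import Summits.Ventures.PercRepro.ProfileFlatUpset

/-!
# PercRepro — THE CONTRACTION MONOTONICITY (G-CM) OF THE UP-SET COLOOP LIMIT, AND (G-CM) ⟹ (G)
(p10, gen 18; `proofs/P10-AVFULL.md` §26(f))

For a finite matroid `M`, an up-set `U` of its flats (`UpFlats`) and a non-loop `e`, the flats `F ∖ e` (`F ∈ U`,
`e ∈ F`) form an up-set `upsetContract U e` of the flats of the contraction `M ／ e` (`upFlats_upsetContract`).
CONJECTURE (G-CM) (`FlatUpsetContractMono`, NOT asserted): the signed sum of the conjecture (G) never increases under
contraction, `Σ_{sepSets (M ／ e) (U ∖ e)} (2 #W − (N − 1) − 1) ≤ Σ_{sepSets M U} (2 #Z − N − 1)` — the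
generalisation of the cell's (CM) «Φ(M, p) ≥ Φ(M ／ e, p)» (13.7 M tests at `n = 9`) from the modular cut of a point
to every up-set of flats; census (gen 18, own code, kit j278761): 0 failures on 78,962 `(M, U, e)` tests at `n ≤ 7`
and on the `n = 8` / `n = 9` catalogues.  KERNEL BRIDGE: (G-CM) ⟹ (G) (`flatUpsetLimit_of_contractMono`), by
contracting non-loops until only loops remain, where the separated family is empty
(`sepSets_eq_empty_of_forall_not_indep`).  With ProfileFlatUpset's bridge, (G-CM) ⟹ (G) ⟹ (C1′).  Nothing here
asserts (G-CM), (G) or (C1′).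
-/

open scoped Matroid

namespace PercRepro.Cogirth

open Finset ThmH Skew

variable {α : Type} [DecidableEq α] {M : Matroid α} [M.Finite]

/-! ### The contraction of an up-set of flats -/

/-- The up-set induced on `M ／ e`: the flats `F ∖ e` for `F ∈ U` containing `e`. -/
noncomputable def upsetContract (U : Finset (Finset α)) (e : α) : Finset (Finset α) :=
  (U.filter (fun F => e ∈ F)).image (fun F => F.erase e)

/-- Membership in `upsetContract`. -/
theorem mem_upsetContract {U : Finset (Finset α)} {e : α} {G : Finset α} :
    G ∈ upsetContract U e ↔ ∃ F ∈ U, e ∈ F ∧ F.erase e = G := by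
  unfold upsetContract
  rw [mem_image]
  constructor
  · rintro ⟨F, hF, rfl⟩
    rw [mem_filter] at hF
    exact ⟨F, hF.1, hF.2, rfl⟩
  · rintro ⟨F, hF, heF, rfl⟩
    exact ⟨F, mem_filter.2 ⟨hF, heF⟩, rfl⟩

omit [DecidableEq α] in
/-- The closure in the contraction: `cl_{M ／ e} X = cl_M (X ∪ e) ∖ e`. -/
theorem coe_clF_contract (e : α) (X : Finset α) :
    ((clF (M ／ ({e} : Set α)) X : Finset α) : Set α) = M.closure (insert e (X : Set α)) \ {e} := by
  rw [coe_clF, Matroid.contract_closure_eq, Set.union_singleton]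

/-- The closure in the contraction, as a finset: `(clF M (insert e X)).erase e`. -/
theorem clF_contract (e : α) (X : Finset α) :
    clF (M ／ ({e} : Set α)) X = (clF M (insert e X)).erase e := by
  apply coe_injective
  rw [coe_clF_contract, coe_erase, coe_clF, coe_insert]

/-- A flat of `M` containing `e` gives a flat `F ∖ e` of `M ／ e`. -/
theorem isFlatF_contract_of_isFlatF {e : α} {F : Finset α} (hF : IsFlatF M F) (he : e ∈ F) :
    IsFlatF (M ／ ({e} : Set α)) (F.erase e) := by
  refine ⟨?_, ?_⟩
  · rw [gr_contract']
    exact erase_subset_erase e hF.1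
  · rw [clF_contract, insert_erase he, hF.2]

/-- A flat of `M ／ e` together with `e` is a flat of `M`. -/
theorem isFlatF_insert_of_isFlatF_contract {e : α} (he : e ∈ gr M) {G : Finset α}
    (hG : IsFlatF (M ／ ({e} : Set α)) G) : IsFlatF M (insert e G) ∧ e ∉ G := by
  have hGg : G ⊆ (gr M).erase e := by rw [← gr_contract']; exact hG.1
  have heG : e ∉ G := fun h => (mem_erase.1 (hGg h)).1 rfl
  refine ⟨⟨insert_subset he (hGg.trans (erase_subset e _)), ?_⟩, heG⟩
  have h1 := hG.2
  rw [clF_contract] at h1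
  have h2 : e ∈ clF M (insert e G) := subset_clF_fu (insert_subset he (hGg.trans (erase_subset e _))) (mem_insert_self e G)
  have h3 : clF M (insert e G) = insert e ((clF M (insert e G)).erase e) := (insert_erase h2).symm
  rw [h3, h1]

/-- The induced family is an up-set of flats of the contraction. -/
theorem upFlats_upsetContract {U : Finset (Finset α)} (hU : UpFlats M U) {e : α} (he : e ∈ gr M) :
    UpFlats (M ／ ({e} : Set α)) (upsetContract U e) where
  flat := by
    intro G hG
    obtain ⟨F, hF, heF, rfl⟩ := mem_upsetContract.1 hG
    exact isFlatF_contract_of_isFlatF (hU.flat F hF) heF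
  up := by
    intro G hG G' hG' hGG'
    obtain ⟨F, hF, heF, rfl⟩ := mem_upsetContract.1 hG
    obtain ⟨hF', heG'⟩ := isFlatF_insert_of_isFlatF_contract he hG'
    rw [mem_upsetContract]
    refine ⟨insert e G', hU.up F hF _ hF' ?_, mem_insert_self e G', erase_insert heG'⟩
    intro x hx
    by_cases hxe : x = e
    · rw [hxe]; exact mem_insert_self e G'
    · exact mem_insert_of_mem (hGG' (mem_erase.2 ⟨hxe, hx⟩))

/-! ### The conjecture (G-CM) and its bridge to (G) -/

/-- **CONJECTURE (G-CM) (NOT asserted)**: for every finite matroid, every up-set of flats and every non-loop `e`, the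
signed sum of (G) at the contraction `M ／ e` with the induced up-set is at most the signed sum at `M`. -/
def FlatUpsetContractMono (α : Type) [DecidableEq α] : Prop :=
  ∀ (M : Matroid α) [M.Finite] (U : Finset (Finset α)), UpFlats M U → ∀ e : α, M.Indep ({e} : Set α) →
    ∑ W ∈ sepSets (M ／ ({e} : Set α)) (upsetContract U e), (2 * (W.card : ℤ) - (gr (M ／ ({e} : Set α))).card - 1) ≤
      ∑ Z ∈ sepSets M U, (2 * (Z.card : ℤ) - (gr M).card - 1)

/-- If every element is a loop, nothing is separated. -/
theorem sepSets_eq_empty_of_forall_not_indep (hloop : ∀ e : α, ¬ M.Indep ({e} : Set α)) (U : Finset (Finset α)) :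
    sepSets M U = ∅ := by
  rw [eq_empty_iff_forall_notMem]
  intro Z hZ
  rw [mem_sepSets, mem_biIndepAll] at hZ
  obtain ⟨⟨hZg, hZr, hZc⟩, hin, hout⟩ := hZ
  have hZind : M.Indep (Z : Set α) := indep_of_rk_eq_card' hZr
  have hcind : M.Indep ((gr M \ Z : Finset α) : Set α) := indep_of_rk_eq_card' hZc
  have hg : gr M = ∅ := by
    rw [eq_empty_iff_forall_notMem]
    intro x hx
    by_cases hxZ : x ∈ Z
    · exact hloop x (hZind.subset (by rw [Set.singleton_subset_iff]; exact_mod_cast hxZ))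
    · have hx' : x ∈ gr M \ Z := mem_sdiff.2 ⟨hx, hxZ⟩
      exact hloop x (hcind.subset (by rw [Set.singleton_subset_iff]; exact_mod_cast hx'))
  have hZ0 : Z = ∅ := subset_empty.1 (hg ▸ hZg)
  rw [hZ0, hg, sdiff_empty] at hout
  rw [hZ0] at hin
  exact hout hin

/-- **(G-CM) ⟹ (G)**: contract non-loops one at a time; when only loops remain the separated family is empty. -/
theorem flatUpsetLimit_of_contractMono (h : FlatUpsetContractMono α) : FlatUpsetLimit α := by
  have key : ∀ n : ℕ, ∀ (M : Matroid α) [M.Finite] (U : Finset (Finset α)), UpFlats M U → (gr M).card = n →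
      0 ≤ ∑ Z ∈ sepSets M U, (2 * (Z.card : ℤ) - (gr M).card - 1) := by
    intro n
    induction n using Nat.strong_induction_on with
    | _ n ih =>
      intro M _ U hU hn
      by_cases hex : ∃ e : α, M.Indep ({e} : Set α)
      · obtain ⟨e, he⟩ := hex
        have heg : e ∈ gr M := mem_gr_of_indep he
        have hpos : 0 < n := hn ▸ card_pos.2 ⟨e, heg⟩
        have hcard : (gr (M ／ ({e} : Set α))).card = n - 1 := by
          rw [gr_contract', card_erase_of_mem heg, hn]
        have h2 := ih (n - 1) (by omega) (M ／ ({e} : Set α)) (upsetContract U e) (upFlats_upsetContract hU heg) hcard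
        exact h2.trans (h M U hU e he)
      · have hloop : ∀ e : α, ¬ M.Indep ({e} : Set α) := fun e he => hex ⟨e, he⟩
        rw [sepSets_eq_empty_of_forall_not_indep hloop, sum_empty]
  intro M _ U hU
  exact key _ M U hU rfl

/-- **(G-CM) ⟹ (C1′)**, through (G). -/
theorem capLimit_of_contractMono (h : FlatUpsetContractMono α) : CapLimit α :=
  capLimit_of_flatUpsetLimit (flatUpsetLimit_of_contractMono h)

end PercRepro.Cogirth
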